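import Literature.Probability.RandomGraphs.PlantedCliqueProgram
import Literature.Computability.Complexity.CodeFPLists
import Literature.Computability.Complexity.CodeFPBudgets
import HarnessLib

/-!
# The AKS program runs in polynomial time (I): adjacency, common neighbourhoods, matrix rows

Polynomial-time realisation of the functional program `AKSProg` (`PlantedCliqueProgram.lean`) on
codes, in the typed `CodeFP` calculus (`Computability/Complexity/CodeFP*.lean`): every component
`g` gets a statement `CodeFP eα eβ g` ("some `f ∈ FP` computes `g` on codes"), assembled from the
calculus' combinators, so that no machine is written here. The input `(n, w)` is coded by
`pairE unE strE`, which is literally the machine input `boolPair 1ⁿ w` of `recoverProb`.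

This file: reading a bit of the edge string (`getD_codeFP`), the row offsets (`rowOffset_codeFP`,
a counted loop), adjacency (`adj_codeFP`), common neighbourhoods (`commonNbrs_codeFP`, a filter),
the sign-matrix entry (`sgnEntry_codeFP`) and one round of power iteration (`matVec_codeFP`).

## References

* S. Arora, B. Barak, *Computational Complexity: A Modern Approach*, CUP 2009, §1.3 (polynomial
  time is closed under composition and polynomially bounded loops) [AroraBarak2009].
* N. Alon, M. Krivelevich, B. Sudakov, *Finding a large hidden clique in a random graph*, Random
  Structures Algorithms 13 (1998), §2.1 ("we can certainly calculate `v₂` in polynomial time")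
  [AlonKrivelevichSudakov1998].
-/

namespace Literature.Probability.RandomGraphs.PlantedClique

namespace AKSProg

open Literature.Computability.Complexity Literature.Computability.Complexity.CodeFP Polynomial
open Literature.Computability.Complexity.Brick (length_dpEnc_le)
open _root_.Computability

/-! ### Reading a bit of the edge string -/

/-- Reading position `q` of a string (default `false`) by dropping and taking. [folklore] -/
theorem getD_eq_decide_take_drop (w : List Bool) (q : ℕ) :
    w.getD q false = decide (((w.drop (min q w.length)).take 1) = [true]) := by
  by_cases hq : q < w.length
  · rw [min_eq_left hq.le, List.getD_eq_getElem _ _ hq, List.drop_eq_getElem_cons hq, List.take_succ_cons,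
      List.take_zero]
    cases w[q] <;> simp
  · push Not at hq
    rw [min_eq_right hq, List.drop_length, List.take_nil, List.getD_eq_default _ _ hq]
    simp

/-- **Bit access is polynomial time**: `(w, q) ↦ w[q]` (default `false`).
[cite: AroraBarak2009, §1.3] -/
theorem getD_codeFP : CodeFP (pairE strE natE) bitE (fun p : List Bool × ℕ => p.1.getD p.2 false) := by
  have hw : CodeFP (pairE strE natE) strE (fun p : List Bool × ℕ => p.1) := fst _ _
  have hq : CodeFP (pairE strE natE) unE (fun p : List Bool × ℕ => min p.2 p.1.length) :=
    unOfNatMin.comp ((strLength.comp hw).pair (snd _ _))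
  have hd : CodeFP (pairE strE natE) strE (fun p : List Bool × ℕ => p.1.drop (min p.2 p.1.length)) :=
    strDrop.comp (hq.pair hw)
  have ht : CodeFP (pairE strE natE) strE
      (fun p : List Bool × ℕ => (p.1.drop (min p.2 p.1.length)).take 1) :=
    strTake.comp ((const _ (1 : ℕ)).pair hd)
  have he : CodeFP (pairE strE natE) bitE
      (fun p : List Bool × ℕ => decide ((p.1.drop (min p.2 p.1.length)).take 1 = [true])) :=
    (CodeFP.eq (eα := strE) (fun _ _ h => h)).comp (ht.pair (const _ [true]))
  exact he.congr fun p => (getD_eq_decide_take_drop p.1 p.2).symm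

/-! ### The row offsets -/

/-- Summing a mapped list by a left fold. [folklore] -/
theorem foldl_add_eq (f : ℕ → ℕ) (l : List ℕ) (acc : ℕ) :
    l.foldl (fun acc a => acc + f a) acc = acc + (l.map f).sum := by
  induction l generalizing acc with
  | nil => simp
  | cons a l ih => rw [List.foldl_cons, ih]; simp; omega

/-- Terms past `n` vanish: `rowOffset n i = rowOffset n (min i n)`. [folklore] -/
theorem rowOffset_min (n i : ℕ) : rowOffset n (min i n) = rowOffset n i := by
  rcases le_total i n with h | h
  · rw [min_eq_left h]
  · rw [min_eq_right h, rowOffset, rowOffset]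
    obtain ⟨d, rfl⟩ := Nat.exists_eq_add_of_le h
    rw [List.range_add, List.map_append, List.sum_append, List.map_map]
    have : (((List.range d).map ((fun i' => n - 1 - i') ∘ fun x => n + x))).sum = 0 :=
      List.sum_eq_zero fun x hx => by
        obtain ⟨y, -, rfl⟩ := List.mem_map.1 hx
        simp only [Function.comp]
        omega
    rw [this, Nat.add_zero]

/-- The row offset as a counted loop. [folklore] -/
theorem rowOffset_eq_foldl (n i : ℕ) :
    rowOffset n i = (List.range (min i n)).foldl (fun acc i' => acc + (n - 1 - i')) 0 := by
  rw [foldl_add_eq, Nat.zero_add, ← rowOffset_min, rowOffset]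

/-- **The row offsets are polynomial time** (a loop of `≤ n` additions of numbers `≤ n`).
[cite: AroraBarak2009, §1.3] -/
theorem rowOffset_codeFP : CodeFP (pairE unE natE) natE (fun p : ℕ × ℕ => rowOffset p.1 p.2) := by
  -- the loop body `(n, i', acc) ↦ acc + (n - 1 - i')`
  have hn : CodeFP (pairE unE (pairE natE natE)) natE (fun t : ℕ × (ℕ × ℕ) => t.1) := natOfUn.comp (fst _ _)
  have hi : CodeFP (pairE unE (pairE natE natE)) natE (fun t : ℕ × (ℕ × ℕ) => t.2.1) := (snd _ _).fst'
  have hacc : CodeFP (pairE unE (pairE natE natE)) natE (fun t : ℕ × (ℕ × ℕ) => t.2.2) := (snd _ _).snd'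
  have hstep : CodeFP (pairE unE (pairE natE natE)) natE
      (fun t : ℕ × (ℕ × ℕ) => t.2.2 + (t.1 - 1 - t.2.1)) :=
    natAdd.comp (hacc.pair (natSub.comp ((natSub.comp (hn.pair (const _ (1 : ℕ)))).pair hi)))
  have hfold := foldl (σ := ℕ) (α := ℕ) (β := ℕ) (eσ := unE) (eα := natE) (eβ := natE)
    (step := fun s a b => b + (s - 1 - a)) (init := fun _ => 0) hstep (const _ (0 : ℕ)) (X ^ 2)
    (fun s l₁ l₂ => by
      rw [eval_pow, eval_X, pairE_apply, length_boolPair, length_unE]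
      refine (length_natE_le _).trans ?_
      have hval : ∀ (l : List ℕ) (acc : ℕ), (∀ a ∈ l, a < s ∨ True) →
          l.foldl (fun b a => b + (s - 1 - a)) acc ≤ acc + l.length * s := by
        intro l
        induction l with
        | nil => intro acc _; simp
        | cons a l ih =>
          intro acc h
          rw [List.foldl_cons]
          refine (ih _ fun x hx => h x (List.mem_cons_of_mem _ hx)).trans ?_
          simp only [List.length_cons]
          have : s - 1 - a ≤ s := by omega
          nlinarith
      have h1 := hval l₁ 0 (fun _ _ => Or.inr trivial)
      rw [Nat.zero_add] at h1
      have h2 : l₁.length ≤ (rawE natE (l₁ ++ l₂)).length :=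
        (List.sublist_append_left l₁ l₂).length_le.trans (length_le_length_rawE natE _)
      nlinarith [Nat.zero_le (rawE natE (l₁ ++ l₂)).length, Nat.zero_le s])
  refine ((hfold.comp ((fst _ _).pair (rangeOf.comp ((fst _ _).pair (snd _ _))))).congr fun p => ?_)
  simp only
  rw [rowOffset_eq_foldl]

/-! ### Adjacency -/

/-- **Adjacency is polynomial time**: `((n, w), (i, j)) ↦ adj n w i j`.
[cite: AroraBarak2009, §1.3] -/
theorem adj_codeFP : CodeFP (pairE (pairE unE strE) (pairE natE natE)) bitE
    (fun p : (ℕ × List Bool) × (ℕ × ℕ) => adj p.1.1 p.1.2 p.2.1 p.2.2) := by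
  have hn : CodeFP (pairE (pairE unE strE) (pairE natE natE)) unE
      (fun p : (ℕ × List Bool) × (ℕ × ℕ) => p.1.1) := (fst _ _).fst'
  have hw : CodeFP (pairE (pairE unE strE) (pairE natE natE)) strE
      (fun p : (ℕ × List Bool) × (ℕ × ℕ) => p.1.2) := (fst _ _).snd'
  have hi : CodeFP (pairE (pairE unE strE) (pairE natE natE)) natE
      (fun p : (ℕ × List Bool) × (ℕ × ℕ) => p.2.1) := (snd _ _).fst'
  have hj : CodeFP (pairE (pairE unE strE) (pairE natE natE)) natE
      (fun p : (ℕ × List Bool) × (ℕ × ℕ) => p.2.2) := (snd _ _).snd'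
  have hb1 : CodeFP (pairE (pairE unE strE) (pairE natE natE)) bitE
      (fun p : (ℕ × List Bool) × (ℕ × ℕ) => p.1.2.getD (rowOffset p.1.1 p.2.1 + (p.2.2 - p.2.1 - 1)) false) :=
    getD_codeFP.comp (hw.pair (natAdd.comp ((rowOffset_codeFP.comp (hn.pair hi)).pair
      (natSub.comp ((natSub.comp (hj.pair hi)).pair (const _ (1 : ℕ)))))))
  have hb2 : CodeFP (pairE (pairE unE strE) (pairE natE natE)) bitE
      (fun p : (ℕ × List Bool) × (ℕ × ℕ) => p.1.2.getD (rowOffset p.1.1 p.2.2 + (p.2.1 - p.2.2 - 1)) false) :=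
    getD_codeFP.comp (hw.pair (natAdd.comp ((rowOffset_codeFP.comp (hn.pair hj)).pair
      (natSub.comp ((natSub.comp (hi.pair hj)).pair (const _ (1 : ℕ)))))))
  have h := (natLt.comp (hi.pair hj)).ite hb1 ((natLt.comp (hj.pair hi)).ite hb2 (const _ false))
  refine h.congr fun p => ?_
  simp only [adj]
  by_cases h1 : p.2.1 < p.2.2
  · simp [h1]
  · by_cases h2 : p.2.2 < p.2.1
    · simp [h1, h2]
    · simp [h1, h2]

/-! ### Common neighbourhoods -/

/-- **The common neighbourhood of a seed tuple is polynomial time**: `((n, w), t) ↦ commonNbrs n w t`.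
[cite: AroraBarak2009, §1.3] -/
theorem commonNbrs_codeFP : CodeFP (pairE (pairE unE strE) (rawE natE)) (rawE natE)
    (fun p : (ℕ × List Bool) × List ℕ => commonNbrs p.1.1 p.1.2 p.2) := by
  -- the test `v ↦ ¬ (v ∈ t) ∧ ∀ u ∈ t, adj n w v u` with context `((n, w), t)`
  have hv : CodeFP (pairE (pairE (pairE unE strE) (rawE natE)) natE) natE
      (fun q : ((ℕ × List Bool) × List ℕ) × ℕ => q.2) := snd _ _
  have ht : CodeFP (pairE (pairE (pairE unE strE) (rawE natE)) natE) (rawE natE)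
      (fun q : ((ℕ × List Bool) × List ℕ) × ℕ => q.1.2) := (fst _ _).snd'
  have hnw : CodeFP (pairE (pairE (pairE unE strE) (rawE natE)) natE) (pairE unE strE)
      (fun q : ((ℕ × List Bool) × List ℕ) × ℕ => q.1.1) := (fst _ _).fst'
  have hmem : CodeFP (pairE (pairE (pairE unE strE) (rawE natE)) natE) bitE
      (fun q : ((ℕ × List Bool) × List ℕ) × ℕ => decide (q.2 ∈ q.1.2)) :=
    (mem natE_injective).comp (hv.pair ht)
  -- the inner `all` over `t` with context `(((n, w), t), v)`
  have hadj : CodeFP (pairE (pairE (pairE (pairE unE strE) (rawE natE)) natE) natE) bitE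
      (fun r : (((ℕ × List Bool) × List ℕ) × ℕ) × ℕ => adj r.1.1.1.1 r.1.1.1.2 r.1.2 r.2) :=
    adj_codeFP.comp (((fst _ _).fst'.fst').pair (((fst _ _).snd').pair (snd _ _)))
  have hall : CodeFP (pairE (pairE (pairE unE strE) (rawE natE)) natE) bitE
      (fun q : ((ℕ × List Bool) × List ℕ) × ℕ => q.1.2.all fun u => adj q.1.1.1 q.1.1.2 q.2 u) :=
    (all hadj).comp ((CodeFP.id _).pair ht)
  have hp : CodeFP (pairE (pairE (pairE unE strE) (rawE natE)) natE) bitE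
      (fun q : ((ℕ × List Bool) × List ℕ) × ℕ =>
        !decide (q.2 ∈ q.1.2) && q.1.2.all fun u => adj q.1.1.1 q.1.1.2 q.2 u) :=
    hmem.not.and hall
  have hfilter := CodeFP.filter (σ := (ℕ × List Bool) × List ℕ) (α := ℕ) hp
  have hrange : CodeFP (pairE (pairE unE strE) (rawE natE)) (rawE natE)
      (fun p : (ℕ × List Bool) × List ℕ => List.range p.1.1) := urange.comp (fst _ _).fst'
  exact (hfilter.comp ((CodeFP.id _).pair hrange)).congr fun p => rfl

/-! ### The sign-matrix entry and one round of power iteration -/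

/-- **The sign-matrix entry is polynomial time**: `((n, w), (a, b)) ↦ sgnEntry n w a b`.
[cite: AroraBarak2009, §1.3] -/
theorem sgnEntry_codeFP : CodeFP (pairE (pairE unE strE) (pairE natE natE)) intE
    (fun p : (ℕ × List Bool) × (ℕ × ℕ) => sgnEntry p.1.1 p.1.2 p.2.1 p.2.2) := by
  have h1 : CodeFP (pairE (pairE unE strE) (pairE natE natE)) intE
      (fun p : (ℕ × List Bool) × (ℕ × ℕ) => if adj p.1.1 p.1.2 p.2.1 p.2.2 then (1 : ℤ) else -1) :=
    adj_codeFP.ite (const (eβ := intE) _ (1 : ℤ)) (const (eβ := intE) _ (-1 : ℤ))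
  have h : CodeFP (pairE (pairE unE strE) (pairE natE natE)) intE
      (fun p : (ℕ × List Bool) × (ℕ × ℕ) => if decide (p.2.1 = p.2.2) then (0 : ℤ) else
        if adj p.1.1 p.1.2 p.2.1 p.2.2 then (1 : ℤ) else -1) :=
    (natEq.comp (snd _ _)).ite (const (eβ := intE) _ (0 : ℤ)) h1
  refine h.congr fun p => ?_
  simp only [sgnEntry]
  by_cases h1 : p.2.1 = p.2.2
  · simp [h1]
  · by_cases h2 : adj p.1.1 p.1.2 p.2.1 p.2.2 = true
    · simp [h1, h2]
    · simp [h1, h2]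

/-- Mapping over a zip is `zipWith`. [folklore] -/
theorem map_zip_eq_zipWith {α β γ : Type} (f : α → β → γ) (l : List α) (l' : List β) :
    (l.zip l').map (fun p => f p.1 p.2) = List.zipWith f l l' := by
  induction l generalizing l' with
  | nil => simp
  | cons a l ih =>
    cases l' with
    | nil => simp
    | cons b l' => simp [ih]

/-- `matVec` through `zipWith`. [folklore] -/
theorem matVec_eq_zipWith (n : ℕ) (w : List Bool) (L : List ℕ) (y : List ℤ) :
    matVec n w L y = L.map fun a => (List.zipWith (fun u v => sgnEntry n w a u * v) L y).sum := by
  simp only [matVec, ← map_zip_eq_zipWith]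

/-- **One round of power iteration is polynomial time**: `(((n, w), L), y) ↦ matVec n w L y`.
[cite: AroraBarak2009, §1.3] -/
theorem matVec_codeFP : CodeFP (pairE (pairE (pairE unE strE) (rawE natE)) (rawE intE)) (rawE intE)
    (fun p : ((ℕ × List Bool) × List ℕ) × List ℤ => matVec p.1.1.1 p.1.1.2 p.1.2 p.2) := by
  -- the summand for a fixed `a`, context `((n, w), a)`, items `(u, v)`
  have e1 : CodeFP (pairE (pairE (pairE unE strE) natE) (pairE natE intE)) (pairE unE strE)
      (fun r : ((ℕ × List Bool) × ℕ) × (ℕ × ℤ) => r.1.1) := (fst _ _).fst'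
  have e2 : CodeFP (pairE (pairE (pairE unE strE) natE) (pairE natE intE)) natE
      (fun r : ((ℕ × List Bool) × ℕ) × (ℕ × ℤ) => r.1.2) := (fst _ _).snd'
  have e3 : CodeFP (pairE (pairE (pairE unE strE) natE) (pairE natE intE)) natE
      (fun r : ((ℕ × List Bool) × ℕ) × (ℕ × ℤ) => r.2.1) := (snd _ _).fst'
  have e4 : CodeFP (pairE (pairE (pairE unE strE) natE) (pairE natE intE)) intE
      (fun r : ((ℕ × List Bool) × ℕ) × (ℕ × ℤ) => r.2.2) := (snd _ _).snd'
  have hsg : CodeFP (pairE (pairE (pairE unE strE) natE) (pairE natE intE)) intE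
      (fun r : ((ℕ × List Bool) × ℕ) × (ℕ × ℤ) => sgnEntry r.1.1.1 r.1.1.2 r.1.2 r.2.1) :=
    (sgnEntry_codeFP.comp (e1.pair (e2.pair e3)) :)
  have hg : CodeFP (pairE (pairE (pairE unE strE) natE) (pairE natE intE)) intE
      (fun r : ((ℕ × List Bool) × ℕ) × (ℕ × ℤ) => sgnEntry r.1.1.1 r.1.1.2 r.1.2 r.2.1 * r.2.2) :=
    (intMul.comp (hsg.pair e4) :)
  have hzip : CodeFP (pairE (pairE (pairE unE strE) natE) (pairE (rawE natE) (rawE intE))) (rawE intE)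
      (fun q : ((ℕ × List Bool) × ℕ) × (List ℕ × List ℤ) =>
        List.zipWith (fun u v => sgnEntry q.1.1.1 q.1.1.2 q.1.2 u * v) q.2.1 q.2.2) :=
    (zipWith (σ := (ℕ × List Bool) × ℕ) (α := ℕ) (β := ℤ) (γ := ℤ) hg :)
  -- the row sum, context `(((n, w), L), y)`, item `a`
  have f1 : CodeFP (pairE (pairE (pairE (pairE unE strE) (rawE natE)) (rawE intE)) natE) (pairE unE strE)
      (fun q : (((ℕ × List Bool) × List ℕ) × List ℤ) × ℕ => q.1.1.1) := (fst _ _).fst'.fst'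
  have f2 : CodeFP (pairE (pairE (pairE (pairE unE strE) (rawE natE)) (rawE intE)) natE) natE
      (fun q : (((ℕ × List Bool) × List ℕ) × List ℤ) × ℕ => q.2) := snd _ _
  have f3 : CodeFP (pairE (pairE (pairE (pairE unE strE) (rawE natE)) (rawE intE)) natE) (rawE natE)
      (fun q : (((ℕ × List Bool) × List ℕ) × List ℤ) × ℕ => q.1.1.2) := (fst _ _).fst'.snd'
  have f4 : CodeFP (pairE (pairE (pairE (pairE unE strE) (rawE natE)) (rawE intE)) natE) (rawE intE)
      (fun q : (((ℕ × List Bool) × List ℕ) × List ℤ) × ℕ => q.1.2) := (fst _ _).snd'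
  have hrow : CodeFP (pairE (pairE (pairE (pairE unE strE) (rawE natE)) (rawE intE)) natE) intE
      (fun q : (((ℕ × List Bool) × List ℕ) × List ℤ) × ℕ =>
        (List.zipWith (fun u v => sgnEntry q.1.1.1.1 q.1.1.1.2 q.2 u * v) q.1.1.2 q.1.2).sum) :=
    (intSum.comp (hzip.comp ((f1.pair f2).pair (f3.pair f4))) :)
  have hmap : CodeFP (pairE (pairE (pairE (pairE unE strE) (rawE natE)) (rawE intE)) (rawE natE)) (rawE intE)
      (fun p : (((ℕ × List Bool) × List ℕ) × List ℤ) × List ℕ => p.2.map fun a =>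
        (List.zipWith (fun u v => sgnEntry p.1.1.1.1 p.1.1.1.2 a u * v) p.1.1.2 p.1.2).sum) :=
    (map (σ := ((ℕ × List Bool) × List ℕ) × List ℤ) (α := ℕ) hrow :)
  have hL : CodeFP (pairE (pairE (pairE unE strE) (rawE natE)) (rawE intE)) (rawE natE)
      (fun p : ((ℕ × List Bool) × List ℕ) × List ℤ => p.1.2) := (fst _ _).snd'
  refine (hmap.comp ((CodeFP.id _).pair hL)).congr fun p => ?_
  rw [matVec_eq_zipWith]
  rfl

/-! ### Power iteration: the accumulator stays polynomially short -/

/-- Sums of lists with entries of absolute value `≤ M`. [folklore] -/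
theorem abs_sum_le_length_mul {M : ℤ} (hM : 0 ≤ M) :
    ∀ l : List ℤ, (∀ q ∈ l, |q| ≤ M) → |l.sum| ≤ l.length * M
  | [], _ => by simp
  | q :: l, h => by
    rw [List.sum_cons, List.length_cons, Nat.cast_succ, add_mul, one_mul, add_comm ((l.length : ℤ) * M)]
    exact (abs_add_le _ _).trans (add_le_add (h q (by simp))
      (abs_sum_le_length_mul hM l fun x hx => h x (List.mem_cons_of_mem _ hx)))

/-- `matVec` has length `|L|`. [folklore] -/
theorem matVec_length (n : ℕ) (w : List Bool) (L : List ℕ) (y : List ℤ) :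
    (matVec n w L y).length = L.length := by
  rw [matVec, List.length_map]

/-- Entries of `matVec` are at most `|L|` times the entries of the vector. [folklore] -/
theorem abs_matVec_le (n : ℕ) (w : List Bool) (L : List ℕ) {y : List ℤ} {M : ℤ} (hM : 0 ≤ M)
    (hy : ∀ v ∈ y, |v| ≤ M) : ∀ v ∈ matVec n w L y, |v| ≤ L.length * M := by
  intro v hv
  rw [matVec, List.mem_map] at hv
  obtain ⟨a, -, rfl⟩ := hv
  have hterm : ∀ q ∈ (L.zip y).map (fun p => sgnEntry n w a p.1 * p.2), |q| ≤ M := by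
    intro q hq
    obtain ⟨p, hp, rfl⟩ := List.mem_map.1 hq
    have hp2 : p.2 ∈ y := (List.of_mem_zip hp).2
    rw [abs_mul]
    have hs : |sgnEntry n w a p.1| ≤ 1 := by unfold sgnEntry; split_ifs <;> simp
    calc |sgnEntry n w a p.1| * |p.2| ≤ 1 * M :=
          mul_le_mul hs (hy _ hp2) (abs_nonneg _) zero_le_one
      _ = M := one_mul M
  have hlen : ((L.zip y).map (fun p => sgnEntry n w a p.1 * p.2)).length ≤ L.length := by
    rw [List.length_map, List.length_zip]; exact min_le_left _ _
  calc |((L.zip y).map fun p => sgnEntry n w a p.1 * p.2).sum|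
      ≤ ((L.zip y).map (fun p => sgnEntry n w a p.1 * p.2)).length * M := abs_sum_le_length_mul hM _ hterm
    _ ≤ L.length * M := by gcongr

/-- After `r` rounds from a vector with entries `≤ M₀` the entries are `≤ |L|ʳ M₀`. [folklore] -/
theorem abs_foldl_matVec_le (n : ℕ) (w : List Bool) (L : List ℕ) {M₀ : ℤ} (hM₀ : 0 ≤ M₀) :
    ∀ (l : List ℕ) (y₀ : List ℤ), (∀ v ∈ y₀, |v| ≤ M₀) →
      ∀ v ∈ l.foldl (fun y _ => matVec n w L y) y₀, |v| ≤ (L.length : ℤ) ^ l.length * M₀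
  | [], y₀, hy₀, v, hv => by simpa using hy₀ v hv
  | a :: l, y₀, hy₀, v, hv => by
    rw [List.foldl_cons] at hv
    have h := abs_foldl_matVec_le n w L (mul_nonneg (by positivity) hM₀) l (matVec n w L y₀)
      (abs_matVec_le n w L hM₀ hy₀) v hv
    calc |v| ≤ (L.length : ℤ) ^ l.length * (L.length * M₀) := h
      _ = (L.length : ℤ) ^ (a :: l).length * M₀ := by rw [List.length_cons, pow_succ]; ring

/-- The iterates keep length `|L|` when started at length `|L|`. [folklore] -/
theorem length_foldl_matVec (n : ℕ) (w : List Bool) (L : List ℕ) :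
    ∀ (l : List ℕ) (y₀ : List ℤ), y₀.length = L.length →
      (l.foldl (fun y _ => matVec n w L y) y₀).length = L.length
  | [], y₀, h => h
  | a :: l, y₀, _ => by rw [List.foldl_cons]; exact length_foldl_matVec n w L l _ (matVec_length n w L _)

/-- Entries of a basis vector are at most `1`. [folklore] -/
theorem abs_basisVec_le (m j : ℕ) : ∀ v ∈ basisVec m j, |v| ≤ 1 := by
  intro v hv
  rw [basisVec, List.mem_map] at hv
  obtain ⟨a, -, rfl⟩ := hv
  split_ifs <;> simp

/-- Length of a basis vector. [folklore] -/
theorem length_basisVec (m j : ℕ) : (basisVec m j).length = m := by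
  rw [basisVec, List.length_map, List.length_range]

/-- The code of an integer of absolute value `≤ mʳ` is short. [folklore] -/
theorem length_intE_le_of_abs_le {v : ℤ} {m r : ℕ} (hv : |v| ≤ (m : ℤ) ^ r) :
    (intE v).length ≤ 3 * (r * m + 1) + 2 := by
  have h1 := length_dpEnc_le v
  have h2 : v.natAbs ≤ m ^ r := by
    have : (v.natAbs : ℤ) ≤ (m : ℤ) ^ r := by rw [Int.natCast_natAbs]; exact hv
    exact_mod_cast this
  have h3 : Nat.size v.natAbs ≤ r * m + 1 :=
    (size_mono h2).trans ((size_pow_le m r).trans (by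
      have := length_natE_le m; rw [length_natE] at this; nlinarith))
  change (Brick.dpEnc v).length ≤ _
  omega

/-- The raw code of a vector with entries of absolute value `≤ mʳ`. [folklore] -/
theorem length_rawE_intE_le {y : List ℤ} {m r : ℕ} (hy : ∀ v ∈ y, |v| ≤ (m : ℤ) ^ r) :
    (rawE intE y).length ≤ y.length * (6 * (r * m + 1) + 6) := by
  rw [length_rawE]
  have : ∀ v ∈ y, 2 * (intE v).length + 2 ≤ 6 * (r * m + 1) + 6 := fun v hv => by
    have := length_intE_le_of_abs_le (hy v hv); omega
  calc (y.map fun v => 2 * (intE v).length + 2).sum ≤ (y.map fun _ => 6 * (r * m + 1) + 6).sum :=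
        List.sum_le_sum this
    _ = y.length * (6 * (r * m + 1) + 6) := by rw [List.map_const', List.sum_replicate, smul_eq_mul]

/-- The basis vector is polynomial time: `(L, j) ↦ basisVec |L| j`. [cite: AroraBarak2009, §1.3] -/
theorem basisVec_codeFP : CodeFP (pairE (rawE natE) natE) (rawE intE)
    (fun p : List ℕ × ℕ => basisVec p.1.length p.2) := by
  have hg : CodeFP (pairE natE natE) intE (fun q : ℕ × ℕ => if decide (q.2 = q.1) then (1 : ℤ) else 0) :=
    (natEq.comp ((snd _ _).pair (fst _ _))).ite (const (eβ := intE) _ (1 : ℤ)) (const (eβ := intE) _ (0 : ℤ))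
  have hmap := (map (σ := ℕ) (α := ℕ) (eσ := natE) (eα := natE) hg :)
  have hr : CodeFP (pairE (rawE natE) natE) (rawE natE) (fun p : List ℕ × ℕ => List.range p.1.length) :=
    urange.comp ((ulength natE).comp (fst _ _))
  refine (hmap.comp ((snd _ _).pair hr)).congr fun p => ?_
  simp only [basisVec]
  exact List.map_congr_left fun a _ => by simp

/-- **Power iteration is polynomial time**: `(((n, w), L), (j, 1ᵗ)) ↦ powerCol n w L j t`
(a loop of `t` rounds whose accumulator has entries `≤ |L|ʳ`, hence codes of length `O(t|L|²)`).
[cite: AlonKrivelevichSudakov1998, §2.1 ("we can certainly calculate `v₂` in polynomial time")] -/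
theorem powerCol_codeFP : CodeFP (pairE (pairE (pairE unE strE) (rawE natE)) (pairE natE unE)) (rawE intE)
    (fun p : ((ℕ × List Bool) × List ℕ) × (ℕ × ℕ) => powerCol p.1.1.1 p.1.1.2 p.1.2 p.2.1 p.2.2) := by
  -- context `σ = (((n, w), L), j)`, items ignored, accumulator `y`
  have hstep : CodeFP (pairE (pairE (pairE (pairE unE strE) (rawE natE)) natE) (pairE natE (rawE intE))) (rawE intE)
      (fun t : (((ℕ × List Bool) × List ℕ) × ℕ) × (ℕ × List ℤ) => matVec t.1.1.1.1 t.1.1.1.2 t.1.1.2 t.2.2) :=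
    (matVec_codeFP.comp (((fst _ _).fst').pair (snd _ _).snd') :)
  have hinit : CodeFP (pairE (pairE (pairE unE strE) (rawE natE)) natE) (rawE intE)
      (fun s : ((ℕ × List Bool) × List ℕ) × ℕ => basisVec s.1.2.length s.2) :=
    (basisVec_codeFP.comp (((fst _ _).snd').pair (snd _ _)) :)
  have hfold := foldl (σ := ((ℕ × List Bool) × List ℕ) × ℕ) (α := ℕ) (β := List ℤ)
    (eσ := pairE (pairE (pairE unE strE) (rawE natE)) natE) (eα := natE) (eβ := rawE intE)
    (step := fun s _ y => matVec s.1.1.1 s.1.1.2 s.1.2 y) (init := fun s => basisVec s.1.2.length s.2)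
    hstep hinit (6 * X ^ 3 + 12 * X) (fun s l₁ l₂ => by
      set m := s.1.2.length with hm
      set N := (pairE (pairE (pairE (pairE unE strE) (rawE natE)) natE) (rawE natE) (s, l₁ ++ l₂)).length with hN
      have hNm : m ≤ N := by
        rw [hN, hm]
        simp only [pairE_apply, length_boolPair]
        have := length_le_length_rawE natE s.1.2
        omega
      have hNr : l₁.length ≤ N := by
        rw [hN]
        simp only [pairE_apply, length_boolPair]
        have := (List.sublist_append_left l₁ l₂).length_le.trans (length_le_length_rawE natE (l₁ ++ l₂))
        omega
      have habs := abs_foldl_matVec_le s.1.1.1 s.1.1.2 s.1.2 zero_le_one l₁ (basisVec m s.2) (abs_basisVec_le m s.2)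
      have hlen := length_foldl_matVec s.1.1.1 s.1.1.2 s.1.2 l₁ (basisVec m s.2) (length_basisVec m s.2)
      simp only [mul_one] at habs
      refine (length_rawE_intE_le habs).trans ?_
      rw [hlen, ← hm, eval_add, eval_mul, eval_mul, eval_pow, eval_X, eval_ofNat, eval_ofNat]
      calc m * (6 * (l₁.length * m + 1) + 6) ≤ N * (6 * (N * N + 1) + 6) := by gcongr
        _ = 6 * N ^ 3 + 12 * N := by ring)
  have hrange : CodeFP (pairE (pairE (pairE unE strE) (rawE natE)) (pairE natE unE)) (rawE natE)
      (fun p : ((ℕ × List Bool) × List ℕ) × (ℕ × ℕ) => List.range p.2.2) := urange.comp (snd _ _).snd'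
  refine ((hfold.comp (((fst _ _).pair (snd _ _).fst').pair hrange)).congr fun p => ?_)
  rfl

/-! ### Sorting the keys: insertion sort as nested folds -/

section Sorting

/-- The code of a key `(|value|, position)`. [folklore] -/
local notation "κE" => pairE intE natE

/-- **The comparison `keyLE` is polynomial time.** [cite: AroraBarak2009, §1.3] -/
theorem keyLE_codeFP : CodeFP (pairE κE κE) bitE (fun p : (ℤ × ℕ) × (ℤ × ℕ) => keyLE p.1 p.2) := by
  have h1 : CodeFP (pairE κE κE) bitE (fun p : (ℤ × ℕ) × (ℤ × ℕ) => decide (p.2.1 < p.1.1)) :=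
    (intLt.comp (((snd _ _).fst').pair (fst _ _).fst') :)
  have h2 : CodeFP (pairE κE κE) bitE (fun p : (ℤ × ℕ) × (ℤ × ℕ) => decide (p.1.1 = p.2.1)) :=
    (intEq.comp (((fst _ _).fst').pair (snd _ _).fst') :)
  have h3 : CodeFP (pairE κE κE) bitE (fun p : (ℤ × ℕ) × (ℤ × ℕ) => decide (p.1.2 ≤ p.2.2)) :=
    (natLe.comp (((fst _ _).snd').pair (snd _ _).snd') :)
  exact (h1.or (h2.and h3)).congr fun p => by simp [keyLE]

/-- One step of the split of a sorted list at a new key `a`: state `(done, before, after)`.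
[folklore] -/
def splitStep (a b : ℤ × ℕ) (st : Bool × (List (ℤ × ℕ) × List (ℤ × ℕ))) :
    Bool × (List (ℤ × ℕ) × List (ℤ × ℕ)) :=
  if st.1 || keyLE a b then (true, (st.2.1, st.2.2 ++ [b])) else (false, (st.2.1 ++ [b], st.2.2))

/-- Once done, the split step only appends to `after`. [folklore] -/
theorem foldl_splitStep_true (a : ℤ × ℕ) :
    ∀ (l tw dw : List (ℤ × ℕ)), l.foldl (fun st b => splitStep a b st) (true, (tw, dw)) = (true, (tw, dw ++ l))
  | [], tw, dw => by simp
  | b :: l, tw, dw => by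
    rw [List.foldl_cons, show splitStep a b (true, (tw, dw)) = (true, (tw, dw ++ [b])) by simp [splitStep],
      foldl_splitStep_true a l, List.append_assoc, List.singleton_append]

/-- **The split fold computes `orderedInsert`**: `before ++ a :: after`. [folklore] -/
theorem orderedInsert_eq_foldl_splitStep (a : ℤ × ℕ) :
    ∀ (l tw : List (ℤ × ℕ)),
      tw ++ l.orderedInsert (fun p q => keyLE p q = true) a =
        (l.foldl (fun st b => splitStep a b st) (false, (tw, []))).2.1 ++
          a :: (l.foldl (fun st b => splitStep a b st) (false, (tw, []))).2.2
  | [], tw => by simp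
  | b :: l, tw => by
    rw [List.foldl_cons]
    by_cases h : keyLE a b = true
    · rw [show splitStep a b (false, (tw, [])) = (true, (tw, [b])) by simp [splitStep, h],
        foldl_splitStep_true, List.orderedInsert, if_pos h, List.singleton_append]
    · rw [show splitStep a b (false, (tw, [])) = (false, (tw ++ [b], [])) by simp [splitStep, h],
        List.orderedInsert, if_neg h, ← orderedInsert_eq_foldl_splitStep a l (tw ++ [b]),
        List.append_assoc, List.singleton_append]

/-- Raw codes of permutations have equal length. [folklore] -/
theorem length_rawE_eq_of_perm {α : Type} (eα : α → List Bool) {l l' : List α} (h : l.Perm l') :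
    (rawE eα l).length = (rawE eα l').length := by
  rw [length_rawE, length_rawE]; exact (h.map _).sum_eq

/-- The split fold only redistributes the items: `before ++ after ~ before₀ ++ after₀ ++ l`.
[folklore] -/
theorem foldl_splitStep_perm (a : ℤ × ℕ) :
    ∀ (l : List (ℤ × ℕ)) (st : Bool × (List (ℤ × ℕ) × List (ℤ × ℕ))),
      ((l.foldl (fun st b => splitStep a b st) st).2.1 ++ (l.foldl (fun st b => splitStep a b st) st).2.2).Perm
        (st.2.1 ++ st.2.2 ++ l)
  | [], st => by simp
  | b :: l, st => by
    rw [List.foldl_cons]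
    refine (foldl_splitStep_perm a l (splitStep a b st)).trans ?_
    have h : ((splitStep a b st).2.1 ++ (splitStep a b st).2.2).Perm (st.2.1 ++ st.2.2 ++ [b]) := by
      unfold splitStep
      split_ifs
      · simp
      · simp only [List.append_assoc]
        exact List.Perm.append_left _ List.perm_append_comm
    calc ((splitStep a b st).2.1 ++ (splitStep a b st).2.2 ++ l).Perm (st.2.1 ++ st.2.2 ++ [b] ++ l) :=
          h.append_right l
      _ = st.2.1 ++ st.2.2 ++ b :: l := by simp

/-- **`orderedInsert` of a key into a list of keys is polynomial time** (one pass).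
[cite: AroraBarak2009, §1.3] -/
theorem orderedInsert_codeFP : CodeFP (pairE κE (rawE κE)) (rawE κE)
    (fun p : (ℤ × ℕ) × List (ℤ × ℕ) => p.2.orderedInsert (fun p q => keyLE p q = true) p.1) := by
  -- the step on `(a, (b, st))`
  have ea : CodeFP (pairE κE (pairE κE (pairE bitE (pairE (rawE κE) (rawE κE))))) κE
      (fun t : (ℤ × ℕ) × ((ℤ × ℕ) × (Bool × (List (ℤ × ℕ) × List (ℤ × ℕ)))) => t.1) := fst _ _
  have eb : CodeFP (pairE κE (pairE κE (pairE bitE (pairE (rawE κE) (rawE κE))))) κE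
      (fun t : (ℤ × ℕ) × ((ℤ × ℕ) × (Bool × (List (ℤ × ℕ) × List (ℤ × ℕ)))) => t.2.1) := (snd _ _).fst'
  have ed : CodeFP (pairE κE (pairE κE (pairE bitE (pairE (rawE κE) (rawE κE))))) bitE
      (fun t : (ℤ × ℕ) × ((ℤ × ℕ) × (Bool × (List (ℤ × ℕ) × List (ℤ × ℕ)))) => t.2.2.1) := (snd _ _).snd'.fst'
  have etw : CodeFP (pairE κE (pairE κE (pairE bitE (pairE (rawE κE) (rawE κE))))) (rawE κE)
      (fun t : (ℤ × ℕ) × ((ℤ × ℕ) × (Bool × (List (ℤ × ℕ) × List (ℤ × ℕ)))) => t.2.2.2.1) :=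
    (snd _ _).snd'.snd'.fst'
  have edw : CodeFP (pairE κE (pairE κE (pairE bitE (pairE (rawE κE) (rawE κE))))) (rawE κE)
      (fun t : (ℤ × ℕ) × ((ℤ × ℕ) × (Bool × (List (ℤ × ℕ) × List (ℤ × ℕ)))) => t.2.2.2.2) :=
    (snd _ _).snd'.snd'.snd'
  have hsb : CodeFP (pairE κE (pairE κE (pairE bitE (pairE (rawE κE) (rawE κE))))) (rawE κE)
      (fun t : (ℤ × ℕ) × ((ℤ × ℕ) × (Bool × (List (ℤ × ℕ) × List (ℤ × ℕ)))) => [t.2.1]) :=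
    (rawSingleton _).comp eb
  have hcond : CodeFP (pairE κE (pairE κE (pairE bitE (pairE (rawE κE) (rawE κE))))) bitE
      (fun t : (ℤ × ℕ) × ((ℤ × ℕ) × (Bool × (List (ℤ × ℕ) × List (ℤ × ℕ)))) => t.2.2.1 || keyLE t.1 t.2.1) :=
    ed.or (keyLE_codeFP.comp (ea.pair eb) :)
  have hthen : CodeFP (pairE κE (pairE κE (pairE bitE (pairE (rawE κE) (rawE κE)))))
      (pairE bitE (pairE (rawE κE) (rawE κE)))
      (fun t : (ℤ × ℕ) × ((ℤ × ℕ) × (Bool × (List (ℤ × ℕ) × List (ℤ × ℕ)))) =>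
        (true, (t.2.2.2.1, t.2.2.2.2 ++ [t.2.1]))) :=
    ((const _ true).pair (etw.pair ((rawAppend _).comp (edw.pair hsb))) :)
  have helse : CodeFP (pairE κE (pairE κE (pairE bitE (pairE (rawE κE) (rawE κE)))))
      (pairE bitE (pairE (rawE κE) (rawE κE)))
      (fun t : (ℤ × ℕ) × ((ℤ × ℕ) × (Bool × (List (ℤ × ℕ) × List (ℤ × ℕ)))) =>
        (false, (t.2.2.2.1 ++ [t.2.1], t.2.2.2.2))) :=
    ((const _ false).pair (((rawAppend _).comp (etw.pair hsb)).pair edw) :)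
  have hstep : CodeFP (pairE κE (pairE κE (pairE bitE (pairE (rawE κE) (rawE κE)))))
      (pairE bitE (pairE (rawE κE) (rawE κE)))
      (fun t : (ℤ × ℕ) × ((ℤ × ℕ) × (Bool × (List (ℤ × ℕ) × List (ℤ × ℕ)))) => splitStep t.1 t.2.1 t.2.2) :=
    (hcond.ite hthen helse).congr fun t => by simp only [splitStep]
  have hinit : CodeFP κE (pairE bitE (pairE (rawE κE) (rawE κE)))
      (fun _ : ℤ × ℕ => ((false, ([], [])) : Bool × (List (ℤ × ℕ) × List (ℤ × ℕ)))) := const _ _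
  have hfold := foldl (σ := ℤ × ℕ) (α := ℤ × ℕ) (β := Bool × (List (ℤ × ℕ) × List (ℤ × ℕ)))
    (eσ := κE) (eα := κE) (eβ := pairE bitE (pairE (rawE κE) (rawE κE)))
    (step := fun a b st => splitStep a b st) (init := fun _ => (false, ([], []))) hstep hinit (3 * X + 6)
    (fun a l₁ l₂ => by
      have hperm := foldl_splitStep_perm a l₁ (false, ([], []))
      simp only [List.nil_append] at hperm
      set st := l₁.foldl (fun st b => splitStep a b st) (false, ([], []))
      rw [eval_add, eval_mul, eval_X, eval_ofNat, eval_ofNat]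
      simp only [pairE_apply, length_boolPair, bitE, List.length_singleton]
      have h1 : (rawE (pairE intE natE) st.2.1).length + (rawE (pairE intE natE) st.2.2).length ≤
          (rawE (pairE intE natE) (l₁ ++ l₂)).length := by
        rw [← List.length_append, ← rawE_append, length_rawE_eq_of_perm _ hperm]
        exact length_rawE_le_of_sublist _ (List.sublist_append_left l₁ l₂)
      omega)
  -- assemble `before ++ a :: after`
  have hres : CodeFP (pairE κE (rawE κE)) (rawE κE)
      (fun p : (ℤ × ℕ) × List (ℤ × ℕ) =>
        (p.2.foldl (fun st b => splitStep p.1 b st) (false, ([], []))).2.1 ++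
          p.1 :: (p.2.foldl (fun st b => splitStep p.1 b st) (false, ([], []))).2.2) :=
    ((rawAppend _).comp (hfold.snd'.fst'.pair ((rawCons _).comp ((fst _ _).pair hfold.snd'.snd'))) :)
  refine hres.congr fun p => ?_
  have h := orderedInsert_eq_foldl_splitStep p.1 p.2 []
  rw [List.nil_append] at h
  exact h.symm

/-- `reverse` as a left fold of `cons`. [folklore] -/
theorem foldl_cons_eq_reverse_append {α : Type} (l acc : List α) :
    l.foldl (fun b a => a :: b) acc = l.reverse ++ acc := by
  induction l generalizing acc with
  | nil => rfl
  | cons a l ih => rw [List.foldl_cons, ih, List.reverse_cons, List.append_assoc]; rfl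

/-- Reversal of raw lists (cf. `CoreDescBlockFP.rawReverse`, reproved to keep imports small).
[folklore] -/
theorem rawReverse_codeFP {α : Type} (eα : α → List Bool) : CodeFP (rawE eα) (rawE eα) List.reverse := by
  have h := foldl₀ (eα := eα) (eβ := rawE eα) (step := fun (a : α) (b : List α) => a :: b) (b₀ := [])
    ((rawCons eα).comp ((fst _ _).pair (snd _ _))) X (fun l₁ l₂ => by
      rw [foldl_cons_eq_reverse_append, List.append_nil, eval_X, length_rawE, length_rawE, List.map_reverse,
        List.sum_reverse]
      exact List.Sublist.sum_le_sum ((List.sublist_append_left l₁ l₂).map _) fun _ _ => Nat.zero_le _)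
  exact h.congr fun l => by rw [foldl_cons_eq_reverse_append, List.append_nil]

/-- Insertion sort as a left fold over the reversed list. [folklore] -/
theorem insertionSort_eq_foldl_reverse {α : Type} (r : α → α → Prop) [DecidableRel r] (l : List α) :
    l.insertionSort r = l.reverse.foldl (fun acc a => acc.orderedInsert r a) [] := by
  rw [List.foldl_reverse]; rfl

/-- **Insertion sort of the keys is polynomial time.** [cite: AroraBarak2009, §1.3] -/
theorem insertionSort_codeFP :
    CodeFP (rawE κE) (rawE κE) (fun l : List (ℤ × ℕ) => l.insertionSort fun p q => keyLE p q = true) := by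
  have hstep : CodeFP (pairE κE (rawE κE)) (rawE κE)
      (fun t : (ℤ × ℕ) × List (ℤ × ℕ) => t.2.orderedInsert (fun p q => keyLE p q = true) t.1) :=
    orderedInsert_codeFP
  have h := foldl₀ (eα := κE) (eβ := rawE κE)
    (step := fun (a : ℤ × ℕ) (acc : List (ℤ × ℕ)) => acc.orderedInsert (fun p q => keyLE p q = true) a)
    (b₀ := []) hstep X (fun l₁ l₂ => by
      rw [eval_X]
      have hperm : (l₁.foldl (fun acc a => acc.orderedInsert (fun p q => keyLE p q = true) a) []).Perm l₁ := by
        rw [← List.reverse_reverse l₁, ← insertionSort_eq_foldl_reverse, List.reverse_reverse]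
        exact (List.perm_insertionSort _ _).trans (List.reverse_perm l₁)
      rw [length_rawE_eq_of_perm _ hperm]
      exact length_rawE_le_of_sublist _ (List.sublist_append_left l₁ l₂))
  exact (h.comp (rawReverse_codeFP _)).congr fun l => by
    simp only [insertionSort_eq_foldl_reverse]

/-- Taking `min k |l|` items is taking `k` items. [folklore] -/
theorem take_min_length {α : Type} (l : List α) (k : ℕ) : l.take (min k l.length) = l.take k := by
  rw [← List.take_take, List.take_length]

/-- **The top-`k'` positions are polynomial time**: `(y, k') ↦ topPositions y k'`.
[cite: AlonKrivelevichSudakov1998, §2.1 (step 2)] -/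
theorem topPositions_codeFP : CodeFP (pairE (rawE intE) natE) (rawE natE)
    (fun p : List ℤ × ℕ => topPositions p.1 p.2) := by
  have hg : CodeFP (pairE (rawE intE) (pairE natE intE)) κE
      (fun r : List ℤ × (ℕ × ℤ) => (|r.2.2|, r.2.1)) :=
    ((intAbs.comp (snd _ _).snd').pair (snd _ _).fst' :)
  have hkeys : CodeFP (rawE intE) (rawE κE) (fun y : List ℤ => y.mapIdx fun a v => (|v|, a)) :=
    ((mapIdx (σ := List ℤ) (α := ℤ) (eσ := rawE intE) (eα := intE) hg).comp
      ((CodeFP.id _).pair (CodeFP.id _)) :)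
  have hsorted : CodeFP (pairE (rawE intE) natE) (rawE κE)
      (fun p : List ℤ × ℕ => (p.1.mapIdx fun a v => (|v|, a)).insertionSort fun p q => keyLE p q = true) :=
    (insertionSort_codeFP.comp (hkeys.comp (fst _ _)) :)
  have hk : CodeFP (pairE (rawE intE) natE) unE
      (fun p : List ℤ × ℕ => min p.2
        ((p.1.mapIdx fun a v => (|v|, a)).insertionSort fun p q => keyLE p q = true).length) :=
    (unOfNatMin.comp (((ulength _).comp hsorted).pair (snd _ _)) :)
  have htake := ((rawTakeUn (pairE intE natE)).comp (hk.pair hsorted) :)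
  have hmap := ((map₀ (snd intE natE)).comp htake :)
  refine hmap.congr fun p => ?_
  simp only [topPositions, take_min_length]

end Sorting

/-! ### The seed tuples: `sublistsLen` by dynamic programming over suffixes -/

section Tuples

/-- The vector `[sublistsLen 0 l, …, sublistsLen s l]`. [folklore] -/
def slVec (s : ℕ) (l : List ℕ) : List (List (List ℕ)) := (List.range (s + 1)).map fun k => l.sublistsLen k

/-- One step of the recursion
`sublistsLen (k+1) (a :: l) = sublistsLen (k+1) l ++ map (a :: ·) (sublistsLen k l)` on the whole
vector. [folklore] -/
def slStep (a : ℕ) (V : List (List (List ℕ))) : List (List (List ℕ)) :=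
  [[]] :: List.zipWith (fun A B => A ++ B.map (List.cons a)) V.tail V

/-- `zipWith` of two maps of the same list. [folklore] -/
theorem zipWith_map_map {α β γ δ : Type} (g : β → γ → δ) (u : α → β) (v : α → γ) :
    ∀ R : List α, List.zipWith g (R.map u) (R.map v) = R.map fun k => g (u k) (v k)
  | [] => rfl
  | a :: R => by
    rw [List.map_cons, List.map_cons, List.zipWith_cons_cons, zipWith_map_map g u v R, List.map_cons]

/-- The vector at `a :: l` from the vector at `l`. [folklore] -/
theorem slVec_cons (s a : ℕ) (l : List ℕ) : slVec s (a :: l) = slStep a (slVec s l) := by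
  have hL : slVec s (a :: l) =
      [[]] :: (List.range s).map fun k => l.sublistsLen (k + 1) ++ (l.sublistsLen k).map (List.cons a) := by
    rw [slVec, List.range_succ_eq_map, List.map_cons, List.sublistsLen_zero, List.map_map]
    congr 1
    exact List.map_congr_left fun k _ => by simp [List.sublistsLen_succ_cons]
  have hV : slVec s l = ((List.range s).map fun k => l.sublistsLen k) ++ [l.sublistsLen s] := by
    rw [slVec, List.range_succ, List.map_append, List.map_singleton]
  have hT : (slVec s l).tail = (List.range s).map fun k => l.sublistsLen (k + 1) := by
    rw [slVec, List.range_succ_eq_map, List.map_cons, List.tail_cons, List.map_map]; rfl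
  rw [hL, slStep, hT, hV]
  congr 1
  rw [← List.append_nil ((List.range s).map fun k => l.sublistsLen (k + 1)), List.zipWith_append (by simp),
    show List.zipWith (fun A B => A ++ B.map (List.cons a)) ([] : List (List (List ℕ))) [l.sublistsLen s] = []
      from rfl, List.append_nil, zipWith_map_map]

/-- The vector at the empty list. [folklore] -/
theorem slVec_nil (s : ℕ) : slVec s [] = [[]] :: List.replicate s [] := by
  rw [slVec, List.range_succ_eq_map, List.map_cons, List.sublistsLen_zero, List.map_map]
  congr 1
  exact List.eq_replicate_iff.2 ⟨by simp, fun b hb => by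
    obtain ⟨k, -, rfl⟩ := List.mem_map.1 hb
    simp⟩

/-- **The DP**: the vector is a left fold of `slStep` over the reversed list. [folklore] -/
theorem slVec_eq_foldl (s : ℕ) (l : List ℕ) :
    slVec s l = l.reverse.foldl (fun V a => slStep a V) ([[]] :: List.replicate s []) := by
  rw [List.foldl_reverse, ← slVec_nil]
  induction l with
  | nil => rfl
  | cons a l ih => rw [List.foldr_cons, ← ih, slVec_cons]

/-- `tuples n s` is entry `s` of the vector at `[0, …, n)`. [folklore] -/
theorem tuples_eq_getD_slVec (n s : ℕ) : tuples n s = (slVec s (List.range n)).getD s [] := by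
  rw [slVec, List.getD_eq_getElem _ _ (by simp), List.getElem_map, List.getElem_range]; rfl

/-- `n.choose r ≤ nʳ`. [folklore] -/
theorem choose_le_pow (n r : ℕ) : n.choose r ≤ n ^ r := by
  have h := (Nat.choose_le_pow_div (α := ℚ) r n).trans
    (div_le_self (by positivity) (by exact_mod_cast Nat.one_le_of_lt (Nat.factorial_pos r)))
  exact_mod_cast h

/-- The code of the DP vector is polynomially short in the code of the list. [folklore] -/
theorem length_rawE_slVec_le (s : ℕ) (l : List ℕ) :
    (rawE (rawE (rawE natE)) (slVec s l)).length ≤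
      (s + 1) * (2 * ((l.length + 1) ^ s * (2 * (rawE natE l).length + 2)) + 2) := by
  rw [length_rawE]
  have hk : ∀ k ∈ List.range (s + 1),
      2 * (rawE (rawE natE) (l.sublistsLen k)).length + 2 ≤
        2 * ((l.length + 1) ^ s * (2 * (rawE natE l).length + 2)) + 2 := by
    intro k hk
    rw [List.mem_range] at hk
    have hA : (rawE (rawE natE) (l.sublistsLen k)).length ≤ (l.sublistsLen k).length * (2 * (rawE natE l).length + 2) := by
      rw [length_rawE]
      have : ∀ c ∈ l.sublistsLen k, 2 * (rawE natE c).length + 2 ≤ 2 * (rawE natE l).length + 2 := fun c hc => by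
        have := length_rawE_le_of_sublist natE (List.mem_sublistsLen.1 hc).1; omega
      refine (List.sum_le_sum this).trans ?_
      rw [List.map_const', List.sum_replicate, smul_eq_mul]
    have hlen : (l.sublistsLen k).length ≤ (l.length + 1) ^ s := by
      rw [List.length_sublistsLen]
      exact ((Nat.choose_le_choose k (Nat.le_succ _)).trans (choose_le_pow _ _)).trans
        (Nat.pow_le_pow_right (Nat.succ_pos _) (by omega))
    nlinarith
  calc ((slVec s l).map fun A => 2 * (rawE (rawE natE) A).length + 2).sum
      ≤ ((slVec s l).map fun _ => 2 * ((l.length + 1) ^ s * (2 * (rawE natE l).length + 2)) + 2).sum :=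
        List.sum_le_sum fun A hA => by
          rw [slVec] at hA
          obtain ⟨k, hk', rfl⟩ := List.mem_map.1 hA
          exact hk k hk'
    _ = (s + 1) * (2 * ((l.length + 1) ^ s * (2 * (rawE natE l).length + 2)) + 2) := by
        rw [List.map_const', List.sum_replicate, smul_eq_mul, slVec, List.length_map, List.length_range]

/-- **`slStep` is polynomial time.** [cite: AroraBarak2009, §1.3] -/
theorem slStep_codeFP : CodeFP (pairE natE (rawE (rawE (rawE natE)))) (rawE (rawE (rawE natE)))
    (fun p : ℕ × List (List (List ℕ)) => slStep p.1 p.2) := by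
  -- `(a, c) ↦ a :: c` mapped over `B` with context `a`
  have hcons : CodeFP (pairE natE (rawE natE)) (rawE natE) (fun q : ℕ × List ℕ => q.1 :: q.2) := rawCons natE
  have hmapB : CodeFP (pairE natE (rawE (rawE natE))) (rawE (rawE natE))
      (fun q : ℕ × List (List ℕ) => q.2.map (List.cons q.1)) :=
    (map (σ := ℕ) (α := List ℕ) (eσ := natE) (eα := rawE natE) hcons :)
  have hg : CodeFP (pairE natE (pairE (rawE (rawE natE)) (rawE (rawE natE)))) (rawE (rawE natE))
      (fun t : ℕ × (List (List ℕ) × List (List ℕ)) => t.2.1 ++ t.2.2.map (List.cons t.1)) :=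
    ((rawAppend _).comp ((snd _ _).fst'.pair (hmapB.comp ((fst _ _).pair (snd _ _).snd'))) :)
  have hzip := (zipWith (σ := ℕ) (α := List (List ℕ)) (β := List (List ℕ)) (γ := List (List ℕ))
    (eσ := natE) (eα := rawE (rawE natE)) (eβ := rawE (rawE natE)) (eγ := rawE (rawE natE)) hg :)
  have htail : CodeFP (pairE natE (rawE (rawE (rawE natE)))) (rawE (rawE (rawE natE)))
      (fun p : ℕ × List (List (List ℕ)) => p.2.tail) := (rawTail _).comp (snd _ _)
  have hz : CodeFP (pairE natE (rawE (rawE (rawE natE)))) (rawE (rawE (rawE natE)))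
      (fun p : ℕ × List (List (List ℕ)) =>
        List.zipWith (fun A B => A ++ B.map (List.cons p.1)) p.2.tail p.2) :=
    (hzip.comp ((fst _ _).pair (htail.pair (snd _ _))) :)
  exact (((rawCons _).comp ((const _ ([[]] : List (List ℕ))).pair hz)).congr fun p => rfl :)

/-- **The seed tuples are polynomial time** (for each fixed `s`): `1ⁿ ↦ tuples n s`, by the DP
over suffixes of `[0, …, n)` whose table has `O(nˢ)` entries. [cite: AroraBarak2009, §1.3] -/
theorem tuples_codeFP (s : ℕ) : CodeFP unE (rawE (rawE natE)) (fun n => tuples n s) := by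
  have hfold := foldl₀ (α := ℕ) (β := List (List (List ℕ))) (eα := natE) (eβ := rawE (rawE (rawE natE)))
    (step := fun a V => slStep a V) (b₀ := [[]] :: List.replicate s [])
    (slStep_codeFP :) ((C (s + 1)) * (2 * ((X + 1) ^ s * (2 * X + 2)) + 2)) (fun l₁ l₂ => by
      have h := length_rawE_slVec_le s l₁.reverse
      rw [slVec_eq_foldl, List.reverse_reverse] at h
      refine h.trans ?_
      simp only [eval_mul, eval_add, eval_pow, eval_X, eval_C, eval_ofNat, eval_one]
      have h1 : l₁.reverse.length ≤ (rawE natE (l₁ ++ l₂)).length := by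
        rw [List.length_reverse]
        exact (List.sublist_append_left l₁ l₂).length_le.trans (length_le_length_rawE natE (l₁ ++ l₂))
      have h2 : (rawE natE l₁.reverse).length ≤ (rawE natE (l₁ ++ l₂)).length := by
        rw [length_rawE_eq_of_perm natE (List.reverse_perm l₁)]
        exact length_rawE_le_of_sublist natE (List.sublist_append_left l₁ l₂)
      gcongr)
  have hrev := ((rawReverse_codeFP natE).comp urange :)
  have hvec : CodeFP unE (rawE (rawE (rawE natE))) (fun n => slVec s (List.range n)) :=
    (hfold.comp hrev).congr fun n => by rw [slVec_eq_foldl]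
  have hget := ((rawGetD (rawE (rawE natE)) (d := ([] : List (List ℕ))) rfl).comp
    (hvec.pair (const _ s)) :)
  exact hget.congr fun n => by rw [tuples_eq_getD_slVec]

end Tuples

/-! ### Clean-up, candidates, the clique test and the selection -/

section Assembly

/-- The code of the program context `((n, w), L)`. [folklore] -/
local notation "ΛE" => pairE (pairE unE strE) (rawE natE)

/-- **The clean-up step is polynomial time**: `(((n, w), L), (W, k')) ↦ cleanup n w L W k'`.
[cite: AlonKrivelevichSudakov1998, §2.1 (step 2, the set `Q`)] -/
theorem cleanup_codeFP : CodeFP (pairE ΛE (pairE (rawE natE) natE)) (rawE natE)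
    (fun p : ((ℕ × List Bool) × List ℕ) × (List ℕ × ℕ) => cleanup p.1.1.1 p.1.1.2 p.1.2 p.2.1 p.2.2) := by
  -- inner test on `r = ((p, a), b)`
  have r_nw : CodeFP (pairE (pairE (pairE ΛE (pairE (rawE natE) natE)) natE) natE) (pairE unE strE)
      (fun r : ((((ℕ × List Bool) × List ℕ) × (List ℕ × ℕ)) × ℕ) × ℕ => r.1.1.1.1) := (fst _ _).fst'.fst'.fst'
  have r_L : CodeFP (pairE (pairE (pairE ΛE (pairE (rawE natE) natE)) natE) natE) (rawE natE)
      (fun r : ((((ℕ × List Bool) × List ℕ) × (List ℕ × ℕ)) × ℕ) × ℕ => r.1.1.1.2) := (fst _ _).fst'.fst'.snd'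
  have r_a : CodeFP (pairE (pairE (pairE ΛE (pairE (rawE natE) natE)) natE) natE) natE
      (fun r : ((((ℕ × List Bool) × List ℕ) × (List ℕ × ℕ)) × ℕ) × ℕ => r.1.2) := (fst _ _).snd'
  have r_b : CodeFP (pairE (pairE (pairE ΛE (pairE (rawE natE) natE)) natE) natE) natE
      (fun r : ((((ℕ × List Bool) × List ℕ) × (List ℕ × ℕ)) × ℕ) × ℕ => r.2) := snd _ _
  have hLa := ((rawGetD natE (d := 0) natE_zero).comp (r_L.pair r_a) :)
  have hLb := ((rawGetD natE (d := 0) natE_zero).comp (r_L.pair r_b) :)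
  have hq : CodeFP (pairE (pairE (pairE ΛE (pairE (rawE natE) natE)) natE) natE) bitE
      (fun r : ((((ℕ × List Bool) × List ℕ) × (List ℕ × ℕ)) × ℕ) × ℕ =>
        adj r.1.1.1.1.1 r.1.1.1.1.2 (r.1.1.1.2.getD r.1.2 0) (r.1.1.1.2.getD r.2 0)) :=
    (adj_codeFP.comp (r_nw.pair (hLa.pair hLb)) :)
  have hfilterW := (CodeFP.filter (σ := (((ℕ × List Bool) × List ℕ) × (List ℕ × ℕ)) × ℕ) (α := ℕ) hq :)
  -- outer test on `q = (p, a)`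
  have q_W : CodeFP (pairE (pairE ΛE (pairE (rawE natE) natE)) natE) (rawE natE)
      (fun q : (((ℕ × List Bool) × List ℕ) × (List ℕ × ℕ)) × ℕ => q.1.2.1) := (fst _ _).snd'.fst'
  have q_k : CodeFP (pairE (pairE ΛE (pairE (rawE natE) natE)) natE) natE
      (fun q : (((ℕ × List Bool) × List ℕ) × (List ℕ × ℕ)) × ℕ => q.1.2.2) := (fst _ _).snd'.snd'
  have hcount : CodeFP (pairE (pairE ΛE (pairE (rawE natE) natE)) natE) natE
      (fun q : (((ℕ × List Bool) × List ℕ) × (List ℕ × ℕ)) × ℕ =>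
        (q.1.2.1.filter fun b => adj q.1.1.1.1 q.1.1.1.2 (q.1.1.2.getD q.2 0) (q.1.1.2.getD b 0)).length) :=
    ((natLength natE).comp (hfilterW.comp ((CodeFP.id _).pair q_W)) :)
  have hpred : CodeFP (pairE (pairE ΛE (pairE (rawE natE) natE)) natE) bitE
      (fun q : (((ℕ × List Bool) × List ℕ) × (List ℕ × ℕ)) × ℕ => decide (3 * q.1.2.2 ≤
        4 * (q.1.2.1.filter fun b => adj q.1.1.1.1 q.1.1.1.2 (q.1.1.2.getD q.2 0) (q.1.1.2.getD b 0)).length)) :=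
    (natLe.comp ((natMul.comp ((const _ (3 : ℕ)).pair q_k)).pair (natMul.comp ((const _ (4 : ℕ)).pair hcount))) :)
  have hfilter := (CodeFP.filter (σ := ((ℕ × List Bool) × List ℕ) × (List ℕ × ℕ)) (α := ℕ) hpred :)
  have hrange : CodeFP (pairE ΛE (pairE (rawE natE) natE)) (rawE natE)
      (fun p : ((ℕ × List Bool) × List ℕ) × (List ℕ × ℕ) => List.range p.1.2.length) :=
    urange.comp ((ulength natE).comp (fst _ _).snd')
  exact (hfilter.comp ((CodeFP.id _).pair hrange)).congr fun p => rfl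

/-- **A candidate is polynomial time**: `((n, w), (t, (j, k'))) ↦ candidate n w t j k'`.
[cite: AlonKrivelevichSudakov1998, §2.3 (Algorithm B, step 3)] -/
theorem candidate_codeFP : CodeFP (pairE (pairE unE strE) (pairE (rawE natE) (pairE natE natE))) (rawE natE)
    (fun p : (ℕ × List Bool) × (List ℕ × (ℕ × ℕ)) => candidate p.1.1 p.1.2 p.2.1 p.2.2.1 p.2.2.2) := by
  have p_nw : CodeFP (pairE (pairE unE strE) (pairE (rawE natE) (pairE natE natE))) (pairE unE strE)
      (fun p : (ℕ × List Bool) × (List ℕ × (ℕ × ℕ)) => p.1) := fst _ _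
  have p_n : CodeFP (pairE (pairE unE strE) (pairE (rawE natE) (pairE natE natE))) unE
      (fun p : (ℕ × List Bool) × (List ℕ × (ℕ × ℕ)) => p.1.1) := (fst _ _).fst'
  have p_t : CodeFP (pairE (pairE unE strE) (pairE (rawE natE) (pairE natE natE))) (rawE natE)
      (fun p : (ℕ × List Bool) × (List ℕ × (ℕ × ℕ)) => p.2.1) := (snd _ _).fst'
  have p_j : CodeFP (pairE (pairE unE strE) (pairE (rawE natE) (pairE natE natE))) natE
      (fun p : (ℕ × List Bool) × (List ℕ × (ℕ × ℕ)) => p.2.2.1) := (snd _ _).snd'.fst'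
  have p_k : CodeFP (pairE (pairE unE strE) (pairE (rawE natE) (pairE natE natE))) natE
      (fun p : (ℕ × List Bool) × (List ℕ × (ℕ × ℕ)) => p.2.2.2) := (snd _ _).snd'.snd'
  have hL : CodeFP (pairE (pairE unE strE) (pairE (rawE natE) (pairE natE natE))) (rawE natE)
      (fun p : (ℕ × List Bool) × (List ℕ × (ℕ × ℕ)) => commonNbrs p.1.1 p.1.2 p.2.1) :=
    (commonNbrs_codeFP.comp (p_nw.pair p_t) :)
  have hy : CodeFP (pairE (pairE unE strE) (pairE (rawE natE) (pairE natE natE))) (rawE intE)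
      (fun p : (ℕ × List Bool) × (List ℕ × (ℕ × ℕ)) =>
        powerCol p.1.1 p.1.2 (commonNbrs p.1.1 p.1.2 p.2.1) p.2.2.1 p.1.1) :=
    (powerCol_codeFP.comp ((p_nw.pair hL).pair (p_j.pair p_n)) :)
  have hW : CodeFP (pairE (pairE unE strE) (pairE (rawE natE) (pairE natE natE))) (rawE natE)
      (fun p : (ℕ × List Bool) × (List ℕ × (ℕ × ℕ)) =>
        topPositions (powerCol p.1.1 p.1.2 (commonNbrs p.1.1 p.1.2 p.2.1) p.2.2.1 p.1.1) p.2.2.2) :=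
    (topPositions_codeFP.comp (hy.pair p_k) :)
  have hQ : CodeFP (pairE (pairE unE strE) (pairE (rawE natE) (pairE natE natE))) (rawE natE)
      (fun p : (ℕ × List Bool) × (List ℕ × (ℕ × ℕ)) =>
        cleanup p.1.1 p.1.2 (commonNbrs p.1.1 p.1.2 p.2.1)
          (topPositions (powerCol p.1.1 p.1.2 (commonNbrs p.1.1 p.1.2 p.2.1) p.2.2.1 p.1.1) p.2.2.2) p.2.2.2) :=
    (cleanup_codeFP.comp ((p_nw.pair hL).pair (hW.pair p_k)) :)
  -- reading `L` at the positions of `Q`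
  have hget : CodeFP (pairE (rawE natE) natE) natE (fun q : List ℕ × ℕ => q.1.getD q.2 0) :=
    rawGetD natE (d := 0) natE_zero
  have hmapQ := (map (σ := List ℕ) (α := ℕ) (eσ := rawE natE) (eα := natE) hget :)
  have hfront : CodeFP (pairE (pairE unE strE) (pairE (rawE natE) (pairE natE natE))) (rawE natE)
      (fun p : (ℕ × List Bool) × (List ℕ × (ℕ × ℕ)) =>
        (cleanup p.1.1 p.1.2 (commonNbrs p.1.1 p.1.2 p.2.1)
          (topPositions (powerCol p.1.1 p.1.2 (commonNbrs p.1.1 p.1.2 p.2.1) p.2.2.1 p.1.1) p.2.2.2) p.2.2.2).map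
          fun a => (commonNbrs p.1.1 p.1.2 p.2.1).getD a 0) :=
    (hmapQ.comp (hL.pair hQ) :)
  exact (((rawAppend natE).comp (hfront.pair p_t)).congr fun p => rfl :)

/-- **The clique test is polynomial time**: `((n, w), C) ↦ isClique n w C`.
[cite: AlonKrivelevichSudakov1998, §2.3 (Algorithm B, step 4)] -/
theorem isClique_codeFP : CodeFP (pairE (pairE unE strE) (rawE natE)) bitE
    (fun p : (ℕ × List Bool) × List ℕ => isClique p.1.1 p.1.2 p.2) := by
  have hinner : CodeFP (pairE (pairE (pairE (pairE unE strE) (rawE natE)) natE) natE) bitE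
      (fun r : (((ℕ × List Bool) × List ℕ) × ℕ) × ℕ => decide (r.1.2 = r.2) || adj r.1.1.1.1 r.1.1.1.2 r.1.2 r.2) :=
    (natEq.comp (((fst _ _).snd').pair (snd _ _))).or
      (adj_codeFP.comp (((fst _ _).fst'.fst').pair (((fst _ _).snd').pair (snd _ _))) :)
  have hall₁ := (all (σ := ((ℕ × List Bool) × List ℕ) × ℕ) (α := ℕ) hinner :)
  have hmid : CodeFP (pairE (pairE (pairE unE strE) (rawE natE)) natE) bitE
      (fun q : ((ℕ × List Bool) × List ℕ) × ℕ =>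
        q.1.2.all fun b => decide (q.2 = b) || adj q.1.1.1 q.1.1.2 q.2 b) :=
    (hall₁.comp ((CodeFP.id _).pair (fst _ _).snd') :)
  have hall₂ := (all (σ := (ℕ × List Bool) × List ℕ) (α := ℕ) hmid :)
  exact ((hall₂.comp ((CodeFP.id _).pair (snd _ _))).congr fun p => rfl :)

/-- **The comparison step is polynomial time**: `((n, w), (best, C)) ↦ better n w best C`.
[cite: AlonKrivelevichSudakov1998, §2.3 (Algorithm B, steps 4–6)] -/
theorem better_codeFP : CodeFP (pairE (pairE unE strE) (pairE (rawE natE) (rawE natE))) (rawE natE)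
    (fun p : (ℕ × List Bool) × (List ℕ × List ℕ) => better p.1.1 p.1.2 p.2.1 p.2.2) := by
  have hb : CodeFP (pairE (pairE unE strE) (pairE (rawE natE) (rawE natE))) (rawE natE)
      (fun p : (ℕ × List Bool) × (List ℕ × List ℕ) => p.2.1) := (snd _ _).fst'
  have hC : CodeFP (pairE (pairE unE strE) (pairE (rawE natE) (rawE natE))) (rawE natE)
      (fun p : (ℕ × List Bool) × (List ℕ × List ℕ) => p.2.2) := (snd _ _).snd'
  have hcl : CodeFP (pairE (pairE unE strE) (pairE (rawE natE) (rawE natE))) bitE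
      (fun p : (ℕ × List Bool) × (List ℕ × List ℕ) => isClique p.1.1 p.1.2 p.2.2) :=
    (isClique_codeFP.comp ((fst _ _).pair hC) :)
  have hlt : CodeFP (pairE (pairE unE strE) (pairE (rawE natE) (rawE natE))) bitE
      (fun p : (ℕ × List Bool) × (List ℕ × List ℕ) => decide (p.2.1.length < p.2.2.length)) :=
    (natLt.comp (((natLength natE).comp hb).pair ((natLength natE).comp hC)) :)
  exact ((hcl.and hlt).ite hC hb).congr fun p => by simp only [better]

/-- **The candidate list is polynomial time** (for each fixed `s`): `(n, w) ↦ candidates n s w`.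
[cite: AlonKrivelevichSudakov1998, §2.3 (Algorithm B, step 2)] -/
theorem candidates_codeFP (s : ℕ) : CodeFP (pairE unE strE) (rawE (rawE natE))
    (fun p : ℕ × List Bool => candidates p.1 s p.2) := by
  -- innermost: `r = ((((n, w), t), j), k') ↦ candidate n w t j (k' + 1)`
  have hcand : CodeFP (pairE (pairE (pairE (pairE unE strE) (rawE natE)) natE) natE) (rawE natE)
      (fun r : (((ℕ × List Bool) × List ℕ) × ℕ) × ℕ => candidate r.1.1.1.1 r.1.1.1.2 r.1.1.2 r.1.2 (r.2 + 1)) :=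
    (candidate_codeFP.comp (((fst _ _).fst'.fst').pair (((fst _ _).fst'.snd').pair
      (((fst _ _).snd').pair (natAdd.comp ((snd _ _).pair (const _ (1 : ℕ))))))) :)
  have hmapk := (map (σ := ((ℕ × List Bool) × List ℕ) × ℕ) (α := ℕ) hcand :)
  -- middle: `q = (((n, w), t), j) ↦ (range n).map (k' ↦ …)`
  have hrow : CodeFP (pairE (pairE (pairE unE strE) (rawE natE)) natE) (rawE (rawE natE))
      (fun q : ((ℕ × List Bool) × List ℕ) × ℕ =>
        (List.range q.1.1.1).map fun k' => candidate q.1.1.1 q.1.1.2 q.1.2 q.2 (k' + 1)) :=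
    (hmapk.comp ((CodeFP.id _).pair (urange.comp (fst _ _).fst'.fst')) :)
  have hmapj := (map (σ := (ℕ × List Bool) × List ℕ) (α := ℕ) hrow :)
  have hblock : CodeFP (pairE (pairE unE strE) (rawE natE)) (rawE (rawE natE))
      (fun q : (ℕ × List Bool) × List ℕ => ((List.range q.1.1).map fun j =>
        (List.range q.1.1).map fun k' => candidate q.1.1 q.1.2 q.2 j (k' + 1)).flatten) :=
    ((flatten _).comp (hmapj.comp ((CodeFP.id _).pair (urange.comp (fst _ _).fst'))) :)
  have hmapt := (map (σ := ℕ × List Bool) (α := List ℕ) hblock :)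
  have htuples : CodeFP (pairE unE strE) (rawE (rawE natE)) (fun p : ℕ × List Bool => tuples p.1 s) :=
    (tuples_codeFP s).comp (fst _ _)
  exact (((flatten _).comp (hmapt.comp ((CodeFP.id _).pair htuples))).congr fun p => rfl :)

/-- The selected candidate is empty or one of the candidates. [folklore] -/
theorem foldl_better_mem (n : ℕ) (w : List Bool) :
    ∀ (l : List (List ℕ)) (b : List ℕ), l.foldl (better n w) b = b ∨ l.foldl (better n w) b ∈ l
  | [], b => Or.inl rfl
  | C :: l, b => by
    rw [List.foldl_cons]
    have hb : better n w b C = b ∨ better n w b C = C := by unfold better; split_ifs <;> simp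
    rcases foldl_better_mem n w l (better n w b C) with h | h
    · rw [h]; rcases hb with hb | hb
      · exact Or.inl hb
      · exact Or.inr (by rw [hb]; exact List.mem_cons_self)
    · exact Or.inr (List.mem_cons_of_mem _ h)

/-- **The selection is polynomial time** (for each fixed `s`): `(n, w) ↦ best n s w`.
[cite: AlonKrivelevichSudakov1998, §2.3 (Algorithm B, steps 4–6)] -/
theorem best_codeFP (s : ℕ) : CodeFP (pairE unE strE) (rawE natE) (fun p : ℕ × List Bool => best p.1 s p.2) := by
  have hstep : CodeFP (pairE (pairE unE strE) (pairE (rawE natE) (rawE natE))) (rawE natE)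
      (fun t : (ℕ × List Bool) × (List ℕ × List ℕ) => better t.1.1 t.1.2 t.2.2 t.2.1) :=
    (better_codeFP.comp ((fst _ _).pair (((snd _ _).snd').pair (snd _ _).fst')) :)
  have hfold := foldl (σ := ℕ × List Bool) (α := List ℕ) (β := List ℕ) (eσ := pairE unE strE)
    (eα := rawE natE) (eβ := rawE natE) (step := fun σ C b => better σ.1 σ.2 b C) (init := fun _ => [])
    hstep (const _ ([] : List ℕ)) X (fun σ l₁ l₂ => by
      rw [eval_X]
      simp only [pairE_apply, length_boolPair]
      have key : (rawE natE (l₁.foldl (fun b a => better σ.1 σ.2 b a) [])).length ≤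
          (rawE (rawE natE) (l₁ ++ l₂)).length := by
        rcases foldl_better_mem σ.1 σ.2 l₁ [] with h | h
        · have h' : l₁.foldl (fun b a => better σ.1 σ.2 b a) [] = [] := h
          rw [h']; simp [rawE]
        · have := length_item_le_length_rawE (rawE natE) (List.mem_append_left l₂ h)
          change 2 * (rawE natE (l₁.foldl (fun b a => better σ.1 σ.2 b a) [])).length + 2 ≤ _ at this
          omega
      omega)
  exact (hfold.comp ((CodeFP.id _).pair (candidates_codeFP s))).congr fun p => rfl

/-- Strings from raw bit lists. [folklore] -/
theorem strOfRawBits_codeFP : CodeFP (rawE bitE) strE (fun l : List Bool => l) := by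
  have hbit : CodeFP bitE strE (fun b : Bool => [b]) := transparent fun _ => rfl
  have hstep : CodeFP (pairE bitE strE) strE (fun t : Bool × List Bool => t.2 ++ [t.1]) :=
    (strAppend.comp ((snd _ _).pair (hbit.comp (fst _ _))) :)
  have h := foldl₀ (α := Bool) (β := List Bool) (eα := bitE) (eβ := strE)
    (step := fun b acc => acc ++ [b]) (b₀ := []) hstep X (fun l₁ l₂ => by
      rw [eval_X, foldl_append_singleton, List.nil_append, List.map_id']
      change l₁.length ≤ _
      exact (List.sublist_append_left l₁ l₂).length_le.trans (length_le_length_rawE bitE _))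
  exact h.congr fun l => by rw [foldl_append_singleton, List.nil_append, List.map_id']

/-- **The AKS program is polynomial time**: for every seed length `s` some `f ∈ FP` computes
`AKSProg.output s` on the machine input `boolPair 1ⁿ w`.
[cite: AlonKrivelevichSudakov1998, §2.3 ("the running time … is still polynomial")] -/
theorem output_codeFP (s : ℕ) : CodeFP (pairE unE strE) strE (output s) := by
  have hmem : CodeFP (pairE (pairE unE strE) natE) bitE
      (fun q : (ℕ × List Bool) × ℕ => decide (q.2 ∈ best q.1.1 s q.1.2)) :=
    ((mem natE_injective).comp ((snd _ _).pair ((best_codeFP s).comp (fst _ _))) :)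
  have hmap := (map (σ := ℕ × List Bool) (α := ℕ) hmem :)
  have hbits : CodeFP (pairE unE strE) (rawE bitE) (output s) :=
    (hmap.comp ((CodeFP.id _).pair (urange.comp (fst _ _)))).congr fun p => rfl
  exact (strOfRawBits_codeFP.comp hbits).congr fun p => rfl

/-- **`AKSProg.output s` is computed by a polynomial-time machine on `boolPair 1ⁿ w`.**
[cite: AlonKrivelevichSudakov1998, §2.3] -/
theorem exists_fp_output (s : ℕ) :
    ∃ f ∈ FP, ∀ (n : ℕ) (w : List Bool), f (boolPair (unaryEncodeNat n) w) = output s (n, w) := by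
  obtain ⟨f, hf, h⟩ := output_codeFP s
  exact ⟨f, hf, fun n w => h (n, w)⟩

end Assembly

end AKSProg

end Literature.Probability.RandomGraphs.PlantedClique
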